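import Literature.IUT.HodgeTheaters.PadicFrobenioidTMPairInner
import Literature.IUT.HodgeTheaters.PadicFrobenioidTMPairIntegrality
import Literature.IUT.HodgeTheaters.ConventionsCatIsomorphismGroup
import Literature.AlgebraicGeometry.Frobenioids.PadicFrobenioidPairIsoExposed
import Literature.AlgebraicGeometry.Frobenioids.ModelFrobenioidPsiBEffective
import Literature.AlgebraicGeometry.Frobenioids.PadicFrobenioidPsiBOfEquivalence
import Literature.AlgebraicGeometry.Frobenioids.PadicFrobenioidFieldUnitsEquivariance
import Literature.AlgebraicGeometry.Frobenioids.PadicFrobenioidMonoidData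
import Literature.AlgebraicGeometry.Frobenioids.PadicFrobenioidSelfEquivalenceRigid
import HarnessLib

/-!
# A self-equivalence of a `p`-adic Frobenioid over the IDENTITY of a genuine base fixes the units `u_τ` of
# base-identity linear endomorphisms (the law `hO` at `𝒞_v`), hence is `≅ 𝟭` — [IUTchI] Cor 5.3 (ii) kernel triviality

S. Mochizuki, *Inter-universal Teichmüller theory I*, kurims manuscript (May 2020), proof of Corollary 5.3 (ii),
p. 144 l. 33–36: «… follows immediately from [AbsTopIII], Proposition 3.2, (iv); …» ([IUTchI] Cor 5.3 (ii) p.144)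
[claim: Mochizuki2012, status: disputed] (D-0012 claim key; this file PROVES statements about the cell's typed
interfaces; nothing of the series is asserted and no side is taken on [IUTchIII] Cor. 3.12).
S. Mochizuki, *The geometry of Frobenioids II*, Kyushu J. Math. **62** (2008) 401–460, proof of Thm. 2.4 (i)/(ii),
p. 20 l. 27 – p. 21 l. 6: «`Ψ` induces … compatible isomorphisms of functors `Φ₁ ⥲ Φ₂`, `B₁ ⥲ B₂`», «a pair of
compatible isomorphisms `G₁ ⥲ G₂`; `K̄₁^× ⥲ K̄₂^×`» [cite: MochizukiFrdII2008, Thm 2.4 (ii) p.21]; *The geometry of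
Frobenioids I*,
Kyushu J. Math. **62** (2008) 293–400, Thm. 5.2 (ii)(iv) pp. 100–102 (`O^▷(A) ⊆ B(A_D)`; units of a Frobenioid of
standard type) [cite: MochizukiFrdI2008, Thm. 5.2(iv) p.102]; S. Mochizuki, *Topics in absolute anabelian geometry
III*, Prop. 3.2 (iv) p. 72 [cite: MochizukiAbsTopIII2015, Proposition 3.2 (iv) p.72].

PROOF-ONLY file (cell abc-iut; layer L1 floor seat abc-iut-L1-t7 gen 9 on the L5 hub row «C53ii/S2c HMON-AT-REAL-CV»,
GO abc-iut-L5-t4 2026-08-27T03:45:55Z; last brick).  abc-iut-L1-t7's `PadicFrobenioidSelfEquivalenceRigid` (p500903)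
reduced the `hker` input of abc-iut-L5-t4's `Cor53.cosetCat_descend_injective_of_kernel_trivial` («every self-equivalence
`Ψ` of `𝒞_v` lying over `𝟭_{𝒟_v}` is `≅ 𝟭`») at a `p`-adic Frobenioid to the SINGLE law
`hO : u_{Ψ τ} = η₀^* u_τ` for every base-identity linear endomorphism `τ`.  This file PROVES `hO` at every fieldwise
saturated `p`-adic Frobenioid over a GENUINE §2 base `φ₁ : Π → G_{ℚ_p}` (open homomorphism, `Π` tempered, temp-slim,
Galois-countable; [FrdII] Ex. 1.3 (ii) / [IUTchI] Ex. 3.2–3.3), and assembles the kernel triviality: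
* §1 `MulEquiv.eq_self_of_forall_norm_le_one` — an automorphism of `K^×` fixing `{‖·‖ ≤ 1}` pointwise is the identity;
* §2 `PadicFrd.Datum.psiB_app_eq_self_of_genuine` — THE RIGIDITY STEP: a natural automorphism `Ψ_B : B ⥲ B` over the
  IDENTITY base functor carrying effective elements to effective elements at the levels `Π/N_k` of a cofinal tower IS THE
  IDENTITY.  Proof = print's: `Ψ_B` induces (abc-iut-w5-d188 / w5-d229's colimit machinery, `E := 𝟭` ON THE NOSE, so the
  Galois component is `id_Π` and NO «inner automorphism» bookkeeping arises) an automorphism `ψ̄` of `ℚ̄_p^×`,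
  `Π`-equivariant THROUGH THE IDENTITY (naturality of `Ψ_B`) and integral (abc-iut-L1's `norm_psibar_le_one_of_levelwise` +
  abc-iut-w4-d077's `hint_of_oneSided`); [AbsTopIII] Prop. 3.2 (iv) in abc-iut-w4-d077's binder-free form
  `PadicTMPair.coe_psibar_apply_eq_self_of_refl` gives `ψ̄ = id` on `𝒪^⊳`, hence on `ℚ̄_p^×` (§1); the legs
  `a ↦ x_k⁻¹·a` being injective, `Ψ_B = id` at every `Π/N_k`, and at every object by cofinality + injectivity of `B(f)`;
* §3 `PadicFrd.Datum.unit_map_eq_pull_of_over_base_genuine` — the law `hO` (abc-iut-L1-d3's `exists_psiB_of_equivalence`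
  with `E := 𝟭` and `hpos_of_equivalence`, then §2), and `PadicFrd.Datum.nonempty_iso_id_of_liesUnder_refl_genuine` —
  `hker` at the genuine datum from p500903, the remaining binders being abc-iut-L5-t4's `IsSlim (CosetCat Π)` and the two
  one-line-per-carrier facts (INT)/(PF) about `Φ ⊆ ord(𝒪^⊳)^rlf` (discharged at `ord(𝒪^⊳)^pf` by
  `Datum.perf_exists_ιHom_eq`).
No definition, instance, notation or `Prop` fact; typed ≠ proved elsewhere; nothing here asserts abc proved or refuted.
-/

noncomputable section

namespace Literature.AlgebraicGeometry.Frobenioids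

open CategoryTheory CategoryTheory.Limits Opposite Topology Filter Function
open Literature.AnabelianGeometry.SemiGraphs Literature.AnabelianGeometry.AbsoluteAnabelian
open Literature.IUT.HodgeTheaters

/-! ### §1 An automorphism of `K^×` fixing the closed unit ball pointwise is the identity -/

/-- If a group automorphism `ψ` of `K^×` (`K` a normed field) fixes every `v` with `‖v‖ ≤ 1`, then `ψ = id`
(apply it to `u` or to `u⁻¹`). [cite: MochizukiFrdII2008, Thm 2.4 (ii) p.21] -/
theorem MulEquiv.eq_self_of_forall_norm_le_one {K : Type*} [NormedField K] (ψ : Kˣ ≃* Kˣ)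
    (h : ∀ v : Kˣ, ‖(v : K)‖ ≤ 1 → ψ v = v) (u : Kˣ) : ψ u = u := by
  by_cases hu : ‖(u : K)‖ ≤ 1
  · exact h u hu
  · have hu' : ‖((u⁻¹ : Kˣ) : K)‖ ≤ 1 := by
      rw [Units.val_inv_eq_inv_val, norm_inv]
      exact inv_le_one_of_one_le₀ (not_le.mp hu).le
    have h1 := h u⁻¹ hu'
    rwa [map_inv, inv_inj] at h1

namespace PadicFrd.Datum

open QuasiTemperoid BaseGaloisSystem

/-! ### §2 Rigidity: a natural automorphism of `B` over the identity of a genuine base, effective-preserving, is the identity -/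

section Genuine

variable {p : ℕ} [Fact p.Prime] {G : Type} [Group G] [TopologicalSpace G] [IsTopologicalGroup G]
  (φ₁ : G →* GalFbar ℚ_[p]) (hφ₁ : IsOpenHom φ₁) (N : ℕ → OpenNormalSubgroup G)
  (d : Datum (CosetCat G) p)

/-- **Rigidity of `B` over the identity of a genuine base** ([FrdII] Thm. 2.4 (ii) + [AbsTopIII] Prop. 3.2 (iv)).  For a
fieldwise saturated `p`-adic Frobenioid datum over the genuine §2 base `Π/U ↦ Spec ℚ̄_p^{φ₁(U)}`
(`φ₁ : Π → G_{ℚ_p}` an open homomorphism) and a cofinal tower `N`, every natural isomorphism `Ψ_B : B ≅ 𝟭^op ⋙ B`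
carrying, at each level `Π/N_k`, elements with effective divisor to elements with effective divisor is the identity:
`Ψ_B(b) = b` for all `b ∈ B(A)`, all `A`.
[cite: MochizukiAbsTopIII2015, Proposition 3.2 (iv) p.72] -/
theorem psiB_app_eq_self_of_genuine (hN : Antitone N)
    (hd : d.base = CosetCat.push φ₁ hφ₁.isOpenMap ⋙ CosetCat.toConnected (isTempered_galFbar ℚ_[p]) ⋙
      galoisPadicFields p)
    (hfs : d.IsFieldwiseSaturated) (hNb : ∀ U ∈ 𝓝 (1 : G), ∃ k, (N k : Set G) ⊆ U)
    (ΨB : d.B ≅ (𝟭 (CosetCat G)).op ⋙ d.B)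
    (hpos : ∀ (k : ℕ) (b : d.B.obj (op (cQ (N k)))) (c : d.Φ.obj (op (cQ (N k)))),
      Frobenioids.divB d.Φ d.B d.divB (op (cQ (N k))) b = Algebra.GrothendieckGroup.of c →
      ∃ c₂ : d.Φ.obj (op ((𝟭 (CosetCat G)).obj (cQ (N k)))),
        Frobenioids.divB d.Φ d.B d.divB (op ((𝟭 (CosetCat G)).obj (cQ (N k)))) (ΨB.hom.app (op (cQ (N k))) b) =
          Algebra.GrothendieckGroup.of c₂)
    (A : (CosetCat G)ᵒᵖ) (b : d.B.obj A) :
    ΨB.hom.app A b = b := by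
  classical
  haveI := hasColimitsOfShape_nat_commMonCat.{0}
  obtain ⟨base, hloc, hc, he, Φ, j, hj, hmono, B, toB0, divB, sq, cart, nz⟩ := d
  have hd' : base = CosetCat.push φ₁ hφ₁.isOpenMap ⋙ CosetCat.toConnected (isTempered_galFbar ℚ_[p]) ⋙
      galoisPadicFields p := hd
  subst hd'
  clear hd
  -- the datum, re-assembled (used only as an explicit argument)
  let dd : Datum (CosetCat G) p := ⟨(CosetCat.push φ₁ hφ₁.isOpenMap ⋙
      CosetCat.toConnected (isTempered_galFbar ℚ_[p]) ⋙ galoisPadicFields p), hloc, hc, he, Φ, j, hj, hmono, B, toB0,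
    divB, sq, cart, nz⟩
  haveI : IsIso toB0 := PadicFrd.Datum.isIso_toB0_of_isFieldwiseSaturated dd hfs
  -- (1) `Ψ_B` as a natural automorphism of `B`, and the induced automorphism `e` of `lim→_k K_{Π/N_k}^×`
  let β : B ≅ B := NatIso.ofComponents (fun X => ΨB.app X) (fun f => ΨB.hom.naturality f)
  let W : colimit (cosetSystem N hN ⋙ B) ≅
      colimit (cosetSystem N hN ⋙ PadicFrd.bZeroOn (CosetCat.push φ₁ hφ₁.isOpenMap ⋙
        CosetCat.toConnected (isTempered_galFbar ℚ_[p]) ⋙ galoisPadicFields p)) :=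
    HasColimit.isoOfNatIso (Functor.isoWhiskerLeft (cosetSystem N hN) (asIso toB0))
  let e : colimit (cosetSystem N hN ⋙ PadicFrd.bZeroOn (CosetCat.push φ₁ hφ₁.isOpenMap ⋙
      CosetCat.toConnected (isTempered_galFbar ℚ_[p]) ⋙ galoisPadicFields p)) ≅
      colimit (cosetSystem N hN ⋙ PadicFrd.bZeroOn (CosetCat.push φ₁ hφ₁.isOpenMap ⋙
          CosetCat.toConnected (isTempered_galFbar ℚ_[p]) ⋙ galoisPadicFields p)) :=
    W.symm ≪≫ HasColimit.isoOfNatIso (Functor.isoWhiskerLeft (cosetSystem N hN) β) ≪≫ W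
  -- (2) `e` is `Π`-equivariant THROUGH THE IDENTITY (naturality of `Ψ_B`)
  have he : ∀ g : G,
      e.hom ≫ colimMap (Functor.whiskerRight (toAutCoset N hN ((fun g : G => g) g)).hom
          (PadicFrd.bZeroOn (CosetCat.push φ₁ hφ₁.isOpenMap ⋙
            CosetCat.toConnected (isTempered_galFbar ℚ_[p]) ⋙ galoisPadicFields p))) =
        colimMap (Functor.whiskerRight (toAutCoset N hN g).hom (PadicFrd.bZeroOn (CosetCat.push φ₁ hφ₁.isOpenMap ⋙
            CosetCat.toConnected (isTempered_galFbar ℚ_[p]) ⋙ galoisPadicFields p))) ≫ e.hom := by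
    intro g
    have h₁ : W.hom ≫ colimMap (Functor.whiskerRight (toAutCoset N hN g).hom
        (PadicFrd.bZeroOn (CosetCat.push φ₁ hφ₁.isOpenMap ⋙
          CosetCat.toConnected (isTempered_galFbar ℚ_[p]) ⋙ galoisPadicFields p))) =
        colimMap (Functor.whiskerRight (toAutCoset N hN g).hom B) ≫ W.hom :=
      PadicFrd.Datum.colimit_toB0_iso_equivariant dd hfs (toAutCoset N hN g).hom
        (c := cosetSystem N hN) (c' := cosetSystem N hN)
    have h₂ := isoOfNatIso_whiskerLeft_hom_whiskerRight_comm (toAutCoset N hN g).hom β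
      (c := cosetSystem N hN) (c' := cosetSystem N hN)
    have h₁' : W.inv ≫ colimMap (Functor.whiskerRight (toAutCoset N hN g).hom B) =
        colimMap (Functor.whiskerRight (toAutCoset N hN g).hom (PadicFrd.bZeroOn (CosetCat.push φ₁ hφ₁.isOpenMap ⋙
            CosetCat.toConnected (isTempered_galFbar ℚ_[p]) ⋙ galoisPadicFields p))) ≫ W.inv := by
      rw [Iso.inv_comp_eq, ← Category.assoc, h₁, Category.assoc, Iso.hom_inv_id, Category.comp_id]
    simp only [e, Iso.trans_hom, Iso.symm_hom, Category.assoc]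
    rw [h₁, reassoc_of% h₂, reassoc_of% h₁']
  -- (3) the levelwise formula: `e [toB0 b]_k = [toB0 (Ψ_B b)]_k`
  have hlw : ∀ (k : ℕ) (b : B.obj (op (cQ (N k)))),
      e.hom (colimit.ι (cosetSystem N hN ⋙ PadicFrd.bZeroOn (CosetCat.push φ₁ hφ₁.isOpenMap ⋙
          CosetCat.toConnected (isTempered_galFbar ℚ_[p]) ⋙ galoisPadicFields p)) k (toB0.app (op (cQ (N k))) b)) =
        colimit.ι (cosetSystem N hN ⋙ PadicFrd.bZeroOn (CosetCat.push φ₁ hφ₁.isOpenMap ⋙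
            CosetCat.toConnected (isTempered_galFbar ℚ_[p]) ⋙ galoisPadicFields p)) k
          (toB0.app (op (cQ (N k))) (ΨB.hom.app (op (cQ (N k))) b)) := by
    intro k b
    have s₁ : W.inv (colimit.ι (cosetSystem N hN ⋙ PadicFrd.bZeroOn (CosetCat.push φ₁ hφ₁.isOpenMap ⋙
        CosetCat.toConnected (isTempered_galFbar ℚ_[p]) ⋙ galoisPadicFields p)) k (toB0.app (op (cQ (N k))) b)) =
        colimit.ι (cosetSystem N hN ⋙ B) k b := by
      have h' : colimit.ι (cosetSystem N hN ⋙ PadicFrd.bZeroOn (CosetCat.push φ₁ hφ₁.isOpenMap ⋙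
          CosetCat.toConnected (isTempered_galFbar ℚ_[p]) ⋙ galoisPadicFields p)) k (toB0.app (op (cQ (N k))) b) =
          W.hom (colimit.ι (cosetSystem N hN ⋙ B) k b) := by
        rw [← CommMonCat.comp_apply, HasColimit.isoOfNatIso_ι_hom, CommMonCat.comp_apply]
        rfl
      rw [h', ← CommMonCat.comp_apply, Iso.hom_inv_id, CommMonCat.id_apply]
    have s₂ : (HasColimit.isoOfNatIso (Functor.isoWhiskerLeft (cosetSystem N hN) β)).hom
        (colimit.ι (cosetSystem N hN ⋙ B) k b) = colimit.ι (cosetSystem N hN ⋙ B) k (ΨB.hom.app (op (cQ (N k))) b) := by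
      rw [← CommMonCat.comp_apply, HasColimit.isoOfNatIso_ι_hom, CommMonCat.comp_apply]
      rfl
    have s₃ : W.hom (colimit.ι (cosetSystem N hN ⋙ B) k (ΨB.hom.app (op (cQ (N k))) b)) =
        colimit.ι (cosetSystem N hN ⋙ PadicFrd.bZeroOn (CosetCat.push φ₁ hφ₁.isOpenMap ⋙
            CosetCat.toConnected (isTempered_galFbar ℚ_[p]) ⋙ galoisPadicFields p)) k
          (toB0.app (op (cQ (N k))) (ΨB.hom.app (op (cQ (N k))) b)) := by
      rw [← CommMonCat.comp_apply, HasColimit.isoOfNatIso_ι_hom, CommMonCat.comp_apply]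
      rfl
    change W.hom ((HasColimit.isoOfNatIso (Functor.isoWhiskerLeft (cosetSystem N hN) β)).hom
      (W.inv (colimit.ι (cosetSystem N hN ⋙ PadicFrd.bZeroOn (CosetCat.push φ₁ hφ₁.isOpenMap ⋙
          CosetCat.toConnected (isTempered_galFbar ℚ_[p]) ⋙ galoisPadicFields p)) k (toB0.app (op (cQ (N k))) b)))) = _
    rw [s₁, s₂, s₃]
  -- (4) descent to `ψ̄ : ℚ̄_p^× ⥲ ℚ̄_p^×`, equivariant through `id_Π`
  obtain ⟨x₁, hx₁⟩ := exists_rep_basePt_seq φ₁ hφ₁ N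
  obtain ⟨ι₁, ι₂, ψbar, hleg₁, hleg₂, hfac, hψbar⟩ :=
    exists_fbarUnitsEquiv_of_equivariant_rep φ₁ hφ₁ φ₁ hφ₁ N hN N hN hNb hNb x₁ hx₁ x₁ hx₁
      (fun g : G => g) e he
  -- (5) integrality of `ψ̄` (abc-iut-L1's orientation for GIVEN witnesses, with `ι := 𝟭`), two-sided by «N3b»
  let ι : cosetSystem N hN ⋙ (CategoryTheory.Equivalence.refl (C := CosetCat G)).functor.op ≅ cosetSystem N hN :=
    Iso.refl _
  have hlw' : ∀ (k : ℕ) (b : B.obj (op (cQ (N k)))),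
      e.hom (colimit.ι (cosetSystem N hN ⋙ PadicFrd.bZeroOn (CosetCat.push φ₁ hφ₁.isOpenMap ⋙
          CosetCat.toConnected (isTempered_galFbar ℚ_[p]) ⋙ galoisPadicFields p)) k (toB0.app (op (cQ (N k))) b)) =
        colimit.ι (cosetSystem N hN ⋙ PadicFrd.bZeroOn (CosetCat.push φ₁ hφ₁.isOpenMap ⋙
            CosetCat.toConnected (isTempered_galFbar ℚ_[p]) ⋙ galoisPadicFields p)) k
          ((PadicFrd.bZeroOn (CosetCat.push φ₁ hφ₁.isOpenMap ⋙
              CosetCat.toConnected (isTempered_galFbar ℚ_[p]) ⋙ galoisPadicFields p)).map (ι.hom.app k)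
            (toB0.app (op ((CategoryTheory.Equivalence.refl (C := CosetCat G)).functor.obj (cQ (N k))))
              (ΨB.hom.app (op (cQ (N k))) b))) := by
    intro k b
    have hmapι : (PadicFrd.bZeroOn (CosetCat.push φ₁ hφ₁.isOpenMap ⋙
        CosetCat.toConnected (isTempered_galFbar ℚ_[p]) ⋙ galoisPadicFields p)).map (ι.hom.app k) = 𝟙 _ :=
      (PadicFrd.bZeroOn (CosetCat.push φ₁ hφ₁.isOpenMap ⋙
        CosetCat.toConnected (isTempered_galFbar ℚ_[p]) ⋙ galoisPadicFields p)).map_id _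
    rw [hlw k b]
    erw [hmapι]
    rfl
  have hint1 : ∀ u : (Fbar ℚ_[p])ˣ, ‖(show PadicAlgCl p from (u : Fbar ℚ_[p]))‖ ≤ 1 →
      ‖(show PadicAlgCl p from ((ψbar u : (Fbar ℚ_[p])ˣ) : Fbar ℚ_[p]))‖ ≤ 1 := fun u hu =>
    norm_psibar_le_one_of_levelwise φ₁ hφ₁ φ₁ hφ₁ N hN dd dd rfl rfl hfs
      (CategoryTheory.Equivalence.refl (C := CosetCat G)) ΨB hNb hpos N hN ι e x₁ x₁ ι₁ ι₂ ψbar hlw' hleg₁ hleg₂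
      hfac u hu
  have hint : ∀ u : (Fbar ℚ_[p])ˣ, ‖(show PadicAlgCl p from (u : Fbar ℚ_[p]))‖ ≤ 1 ↔
      ‖(show PadicAlgCl p from ((ψbar u : (Fbar ℚ_[p])ˣ) : Fbar ℚ_[p]))‖ ≤ 1 :=
    PadicTMPair.hint_of_oneSided ψbar hint1
  -- (6) [AbsTopIII] Prop. 3.2 (iv): `ψ̄ = id` on `𝒪^⊳`, hence everywhere (§1)
  have hψO : ∀ x : ↥(nonzeroIntegers ℚ_[p] (Fbar ℚ_[p])),
      ((ψbar (ModelMLFGaloisData.toUnit x) : (Fbar ℚ_[p])ˣ) : Fbar ℚ_[p]) = (x : Fbar ℚ_[p]) := fun x =>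
    PadicTMPair.coe_psibar_apply_eq_self_of_refl φ₁ hφ₁ ψbar hint hψbar x
  have hψ : ∀ u : (Fbar ℚ_[p])ˣ, ψbar u = u := by
    refine MulEquiv.eq_self_of_forall_norm_le_one (K := PadicAlgCl p) ψbar fun v hv => ?_
    have hmem : (v : Fbar ℚ_[p]) ∈ nonzeroIntegers ℚ_[p] (Fbar ℚ_[p]) :=
      ⟨(PadicAlgCl.mem_integersClosure_iff (show PadicAlgCl p from (v : Fbar ℚ_[p]))).mpr hv, v.ne_zero⟩
    have hx : ModelMLFGaloisData.toUnit (⟨(v : Fbar ℚ_[p]), hmem⟩ : ↥(nonzeroIntegers ℚ_[p] (Fbar ℚ_[p]))) = v :=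
      Units.ext rfl
    have h := hψO ⟨(v : Fbar ℚ_[p]), hmem⟩
    rw [hx] at h
    exact Units.ext h
  -- (7) `Ψ_B = id` at the levels `Π/N_k`: the legs `a ↦ x_k⁻¹·a` and `toB0` are injective
  have hlevel : ∀ (k : ℕ) (b : B.obj (op (cQ (N k)))), ΨB.hom.app (op (cQ (N k))) b = b := by
    intro k b
    have h1 : ι₁.hom (colimit.ι (cosetSystem N hN ⋙ PadicFrd.bZeroOn (CosetCat.push φ₁ hφ₁.isOpenMap ⋙
        CosetCat.toConnected (isTempered_galFbar ℚ_[p]) ⋙ galoisPadicFields p)) k (toB0.app (op (cQ (N k))) b)) =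
        ι₂.hom (colimit.ι (cosetSystem N hN ⋙ PadicFrd.bZeroOn (CosetCat.push φ₁ hφ₁.isOpenMap ⋙
            CosetCat.toConnected (isTempered_galFbar ℚ_[p]) ⋙ galoisPadicFields p)) k
          (toB0.app (op (cQ (N k))) (ΨB.hom.app (op (cQ (N k))) b))) := by
      rw [← hlw k b, ← hfac, hψ]
    have h2 := congrArg (fun w : (Fbar ℚ_[p])ˣ => (w : Fbar ℚ_[p])) h1
    dsimp only at h2
    rw [hleg₁, hleg₂] at h2
    have h3 := Units.ext (Subtype.val_injective ((x₁ k)⁻¹.injective h2))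
    exact (PadicFrd.Datum.toB0_injective dd _ h3).symm
  -- (8) at every object, by cofinality of the tower and injectivity of `B(f)`
  obtain ⟨k, hk⟩ := hNb ((unop A).sg : Set G) ((unop A).sg.isOpen.mem_nhds (unop A).sg.one_mem)
  let f : cQ (N k) ⟶ unop A :=
    CosetCat.homMk ((1 : G) : (unop A).carrier) fun u hu => (CosetCat.smul_one_eq_one_iff (unop A) u).mpr (hk hu)
  have hnat := ΨB.hom.naturality (f.op : A ⟶ op (cQ (N k)))
  have h1 : (B.map f.op ≫ ΨB.hom.app (op (cQ (N k)))) b =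
      (ΨB.hom.app A ≫ ((𝟭 (CosetCat G)).op ⋙ B).map f.op) b := by rw [hnat]
  rw [CommMonCat.comp_apply, CommMonCat.comp_apply, hlevel k] at h1
  exact PadicFrd.Datum.map_B_injective dd f h1.symm

end Genuine

/-! ### §3 The law `hO` at a genuine `p`-adic Frobenioid, and kernel triviality `hker` ([IUTchI] Cor 5.3 (ii)) -/

section Law

variable {p : ℕ} [Fact p.Prime] {G : Type} [Group G] [TopologicalSpace G] [IsTopologicalGroup G]
  [SecondCountableTopology G] (hG : IsTempered G) (hZ : IsSlimGroup G)
  (φ₁ : G →* GalFbar ℚ_[p]) (hφ₁ : IsOpenHom φ₁) (d : Datum (CosetCat G) p)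

include hG hZ in
/-- **The law `hO` at `𝒞_v`** (row «C53ii/S2c», last input): for a fieldwise saturated `p`-adic Frobenioid over a genuine §2
base (`Π` tempered, temp-slim, Galois-countable; `φ₁ : Π → G_{ℚ_p}` open), every self-equivalence `Ψ` lying over the
identity of the base (`η₀ : Ψ ⋙ Base ≅ Base`) FIXES, through `η₀`, the unit coordinate of every base-identity linear
endomorphism: `u_{Ψ τ} = η₀^*(u_τ)`.  Print: `Ψ` induces `Ψ_B` on `O^▷(−)` ([FrdI] Thm. 3.4 (iv), [FrdII] Thm. 2.4 (i);
abc-iut-L1-d3's `exists_psiB_of_equivalence` with `E := 𝟭`), and `Ψ_B = id` by §2.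
([IUTchI] Cor 5.3 (ii) p.144) [claim: Mochizuki2012, status: disputed] -/
theorem unit_map_eq_pull_of_over_base_genuine
    (hd : d.base = CosetCat.push φ₁ hφ₁.isOpenMap ⋙ CosetCat.toConnected (isTempered_galFbar ℚ_[p]) ⋙
      galoisPadicFields p)
    (hfs : d.IsFieldwiseSaturated) (Ψ : d.frobenioid ≌ d.frobenioid)
    (η₀ : Ψ.functor ⋙ ModelFrobenioid.baseFunctor d.Φ d.B d.divB ≅ ModelFrobenioid.baseFunctor d.Φ d.B d.divB)
    (X : d.frobenioid) (τ : X ⟶ X) (h1 : ModelFrobenioid.degFr τ = 1) (hb : ModelFrobenioid.baseMap τ = 𝟙 X.base) :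
    ModelFrobenioid.unit (Ψ.functor.map τ) =
      Frobenioids.pull d.B (A := X.base) (B := (Ψ.functor.obj X).base) (η₀.hom.app X) (ModelFrobenioid.unit τ) := by
  obtain ⟨N, hN, hNb⟩ := exists_antitone_cofinal_seq hG
  let η : Ψ.functor ⋙ ModelFrobenioid.baseFunctor d.Φ d.B d.divB ≅
      ModelFrobenioid.baseFunctor d.Φ d.B d.divB ⋙ 𝟭 (CosetCat G) :=
    η₀ ≪≫ (ModelFrobenioid.baseFunctor d.Φ d.B d.divB).rightUnitor.symm
  obtain ⟨ΨB, hΨB⟩ := exists_psiB_of_equivalence hG hZ hG hZ Ψ (𝟭 (CosetCat G)) η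
  have hpos := fun (k : ℕ) (b : d.B.obj (op (cQ (N k)))) (c : d.Φ.obj (op (cQ (N k))))
      (h : Frobenioids.divB d.Φ d.B d.divB (op (cQ (N k))) b = Algebra.GrothendieckGroup.of c) =>
    hpos_of_equivalence hG hZ hG hZ Ψ (𝟭 (CosetCat G)) η ΨB hΨB (cQ (N k)) b c h
  have hid : ΨB.hom.app (op X.base) (ModelFrobenioid.unit τ) = ModelFrobenioid.unit τ :=
    psiB_app_eq_self_of_genuine φ₁ hφ₁ N d hN hd hfs hNb ΨB hpos _ _
  have hτ : τ ∈ PreFrobenioid.endSubmonoid d.structureFunctor X :=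
    (ModelFrobenioid.mem_endSubmonoid_iff τ).mpr ⟨hb, h1⟩
  rw [hΨB X τ hτ, hid]
  have hη : η.hom.app X = η₀.hom.app X := by
    change η₀.hom.app X ≫ 𝟙 _ = η₀.hom.app X
    exact Category.comp_id _
  rw [hη]
  rfl

include hG hZ in
/-- **Kernel triviality of `Aut(𝒞_v) → Aut(𝒟_v)` at a genuine `p`-adic Frobenioid** ([IUTchI] Cor 5.3 (ii), injectivity
half, in abc-iut-L5-t4's `hker` spelling): for a fieldwise saturated `p`-adic Frobenioid over a genuine §2 base with slim coset
base, (INT) and (PF), every self-equivalence lying over `𝟭_{𝒟_v}` (`LiesUnder … (Equivalence.refl)`) is `≅ 𝟭`.  From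
abc-iut-L1-t7's `nonempty_iso_id_of_liesUnder_refl_of_endUnits` (p500903: unit rigidity [FrdI] Thm. 5.2 (iv)/Prop. 5.6,
`hdiv` p500370, `hdeg` [FrdI] Thm. 3.4 (iii)) and the law `hO` above; FSM-type and rank one are tree theorems
(`CosetCat.isOfFSMType`, `IsMonoprime.dvd_total`). ([IUTchI] Cor 5.3 (ii) p.144) [claim: Mochizuki2012, status: disputed] -/
theorem nonempty_iso_id_of_liesUnder_refl_genuine (hsl : IsSlim (CosetCat G))
    (hd : d.base = CosetCat.push φ₁ hφ₁.isOpenMap ⋙ CosetCat.toConnected (isTempered_galFbar ℚ_[p]) ⋙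
      galoisPadicFields p)
    (hfs : d.IsFieldwiseSaturated)
    (hint : ∀ (A : CosetCat G) (a : OrdInt (d.fld A)), ∃ c : d.Φ.obj (op A), d.ιHom A c = Realification.of _ a)
    (hpf : ∀ (A : CosetCat G) (c : d.Φ.obj (op A)), ∃ n : ℕ, 0 < n ∧ ∃ a : OrdInt (d.fld A),
      d.ιHom A (c ^ n) = Realification.of _ a)
    (Ψ : d.frobenioid ≌ d.frobenioid)
    (h : Nonempty (CatIsomorphism.LiesUnder (ModelFrobenioid.baseFunctor d.Φ d.B d.divB)
      (ModelFrobenioid.baseFunctor d.Φ d.B d.divB) Ψ (CategoryTheory.Equivalence.refl (C := CosetCat G)))) :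
    Nonempty (Ψ.functor ≅ 𝟭 d.frobenioid) := by
  obtain ⟨h⟩ := h
  exact d.nonempty_iso_id_of_liesUnder_refl_of_endUnits CosetCat.isOfFSMType hsl hint hpf
    (fun A z z' => (d.isMonoprime A).dvd_total z' z) Ψ h (fun _ _ φ => degFr_map_of_equivalence hG hZ Ψ φ)
    (fun η₀ X τ h1 hb => d.unit_map_eq_pull_of_over_base_genuine hG hZ φ₁ hφ₁ hd hfs Ψ η₀ X τ h1 hb)

include hG hZ in
/-- The same as the `∀ Ψ`-clause LITERALLY consumed by abc-iut-L5-t4's `Cor53.cosetCat_descend_injective_of_kernel_trivial`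
(its hypothesis `hker`, binder for binder). ([IUTchI] Cor 5.3 (ii) p.144) [claim: Mochizuki2012, status: disputed] -/
theorem hker_genuine (hsl : IsSlim (CosetCat G))
    (hd : d.base = CosetCat.push φ₁ hφ₁.isOpenMap ⋙ CosetCat.toConnected (isTempered_galFbar ℚ_[p]) ⋙
      galoisPadicFields p)
    (hfs : d.IsFieldwiseSaturated)
    (hint : ∀ (A : CosetCat G) (a : OrdInt (d.fld A)), ∃ c : d.Φ.obj (op A), d.ιHom A c = Realification.of _ a)
    (hpf : ∀ (A : CosetCat G) (c : d.Φ.obj (op A)), ∃ n : ℕ, 0 < n ∧ ∃ a : OrdInt (d.fld A),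
      d.ιHom A (c ^ n) = Realification.of _ a) :
    ∀ Ψ : d.frobenioid ≌ d.frobenioid,
      Nonempty (CatIsomorphism.LiesUnder (ModelFrobenioid.baseFunctor d.Φ d.B d.divB)
        (ModelFrobenioid.baseFunctor d.Φ d.B d.divB) Ψ (CategoryTheory.Equivalence.refl (C := CosetCat G))) →
      Nonempty (Ψ.functor ≅ 𝟭 d.frobenioid) :=
  fun Ψ h => d.nonempty_iso_id_of_liesUnder_refl_genuine hG hZ φ₁ hφ₁ hsl hd hfs hint hpf Ψ h

end Law

end PadicFrd.Datum

end Literature.AlgebraicGeometry.Frobenioids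

end
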